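import Mathlib
import HarnessLib
import HarnessLib.Audit
import Summits.NavierStokesRegularity.Statement
import Literature.Analysis.FluidPDE.ClassicalSolution
import Literature.Analysis.FluidPDE.LerayHopf
import Literature.Analysis.FluidPDE.SuitableWeak
import Literature.Analysis.FluidPDE.LocalTypeI
import Literature.Analysis.FluidPDE.LeslieShvydkoy2018MorreyBoundHolds
import Literature.Analysis.FluidPDE.EnstrophySplitting
import Literature.Analysis.FluidPDE.GKPRigidityBackwardUniqueness
import Literature.Analysis.FluidPDE.SelfSimilar
import Summits.NavierStokesRegularity.NavierStokesRegularity.Theses.RootDecompTerminalEnergy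
import Summits.NavierStokesRegularity.NavierStokesRegularity.Theses.RootDecompAlignedCore
import Summits.NavierStokesRegularity.NavierStokesRegularity.Theses.VorticityPace
import Summits.NavierStokesRegularity.NavierStokesRegularity.Theorems.TerminalTraceBlowupHasSingularPoint
import Summits.NavierStokesRegularity.NavierStokesRegularity.Theorems.QuarterJoltTypeIEnergyEquality
import Summits.NavierStokesRegularity.NavierStokesRegularity.Theorems.QuarterJoltNoTerminalJoltPosition
import HarnessLib.Audit.Status.Attr

/-!
Route: RootDecompLitSlice

# Route RootDecompLitSlice — Root decomposition g3 under N1's residual E₂ — Clay (A) ⟸ P1 ∧ P2 ∧ J1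
∧ U ∧ T₃ᴸ ∧ G₂ᴸ ∧ D — «THE LIT SLICE» (the terminal slice of a first blow-up is dark on no ball;
every printed NSI blow-up lives in the dark cells this evicts)

ROOT DECOMPOSITION CELL decomp-ns (D-0178/D-0179, RESIDUAL MODE, blocker-first), node booked by
route-writer decomp-ns-writer-1 (g3): the critic-CLEARED lens-6 (g6)
node LitSlice («barrier-complement carving», run on N1's residual E₂ =
`RootDecompTerminalEnergy.NoTameTypeII` stmt-NavierStokesRegularity-24828; CRITIC-LEDGER
row 63 CLEARED). PARENT POINTER: refines N1 `route-NavierStokesRegularity-RootDecompTerminalEnergy`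
at :24828 (E₂ REPLACED here by U ∧ T₃ᴸ ∧ G₂ᴸ ∧ D; kernel
`noTameTypeII_of_lit_of_noDarkBall` U → T₃ᴸ → G₂ᴸ → D → E₂ and the EXACTNESS
`noTameTypeII_iff_litDarkCells` E₂ ⟺ U ∧ T₃ᴸ ∧ T₃ᴰ ∧ G₂ᴸ ∧ G₂ᴰ with
D ⟹ T₃ᴰ ∧ G₂ᴰ); N1's other items P1 = stmt-1217, P2 = stmt-24827, J1 = stmt-24829 are carried
VERBATIM (dedup by signature); concludes the ROOT
`NavierStokesRegularity` (no `--refines` verb; the child closing is the lens theorem `closes_N1`,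
HOME/decomp-ns-lens-6/LitSlice.lean sha256
6c6e56dc3c387250e23dfaab2d9d1e804e352d31846e24000abda897867b5afb (821 lines; lean rc 0 / 0 err / 0
warn / 0 sorry per lens-6 g6 + critic row 63; statements extracted verbatim by regex in
litslice/spec.py)).

THESIS. It suffices to show X = P1 ∧ P2 ∧ J1 ∧ U ∧ T₃ᴸ ∧ G₂ᴸ ∧ D. Frame throughout: a maximal smooth
solution (u, p) of lifespan T > 0, viscosity ν > 0,
Leray–Hopf on [0,T] from its own rapidly decaying datum u(0); «tame» = u(t) → u(T) in L² as t ↑ T;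
at a vertex x₀ the terminal SCAR is r⁻¹∫_{B_r(x₀)}|u(T)|²,
the parabolic BUDGET is sup_{t ∈ (T−r²,T)} r⁻¹∫_{B_r(x₀)}|u(t)|², «backward bounded» = |u| ≤ C on
some (T−r²,T) × B_r(x₀); the NEW BIT: x₀ is DARK if u(T) = 0
a.e. on some ball B_ρ(x₀) (an a.e. statement on `volume.restrict (ball x₀ ρ)` — junk-free), LIT
otherwise.
- D (`NoDarkBall`, crux r3, NEW, TAME-FREE, FIRST PROVER TARGET): the terminal slice u(T) of a first
blow-up vanishes a.e. on NO ball. Skeleton D ⟸ D₁ ∧ D₂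
  (`noDarkBall_of_spreads`, kernel): D₁ (`DarkBallSpreads`, aside) a dark ball spreads to the whole
slice — CKN slice nullity H¹(Sing_T) = 0, space-like unique
  continuation (Escauriaza–Fernández–Vessella two-sphere one-cylinder inequality at regular slice
points, arXiv:math/0611462 Thm 2) for the vorticity
  inequality, curl = div = 0 ⟹ harmonic ⟹ identity theorem; D₂ (`NoGlobalExtinction`, aside) the
slice is not globally extinct — ENGINE LANDED
  (`Literature.Analysis.FluidPDE.IsClassicalNSSolutionOn.curl_eq_zero_of_farField_of_tendsto`, GKP
2016 Prop. 2.3 over ESS 2003) and PLUGGED (lens theorem `curl_eq_zero_of_extinct_of_farField`,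
PROVED, shipped as the BC5 rung: global
  darkness + far-field derivative bounds ⟹ curl u ≡ 0 on (T₄,T) × ℝ³); remaining inputs in tree
(`leray_solution_farField_bound_slab_holds`, Serrin exterior
  regularity, L² Liouville, extension by zero).
- T₃ᴸ (`NoLitInvisibleTransient`, crux r2, NEW, DECLARED RESIDUAL): in a tame blow-up, a LIT vertex
with bounded scar has bounded budget (g4's T₃ restricted to lit
  vertices; T₃ ⟺ T₃ᴸ ∧ T₃ᴰ, D ⟹ T₃ᴰ).
- G₂ᴸ (`LitCriticalSingularityIsTypeI`, crux r4, NEW, attacked by inheritance): a tame blow-up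
possessing a LIT budget-bounded vertex that is not backward bounded
  is Type I (g4's G₂ restricted; G₂ ⟺ G₂ᴸ ∧ G₂ᴰ, D ⟹ G₂ᴰ); skeleton = Seregin's energy-Type-I zoom
(two printed stubs) + the tree's KNSS Liouville item (L)
  `VorticityPace.Liouville` stmt-10551.
- U (`NoSupercriticalTameScar`, crux r5, g4 VERBATIM, first birth, DECLARED RESIDUAL — Tao-LOADED):
a tame blow-up has bounded terminal scar at every vertex
  (unchanged by g6: a dark vertex has scar 0, `scar_of_dark`).
- P1 (`NoTypeIBlowup` = 1217), P2 (`NoEnergyAtom` = 24827), J1 (`AtomFreeBlowupIsTame` = 24829):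
N1's items verbatim.
Lean: `theorem closes (hI : NoTypeIBlowup) (hA : NoEnergyAtom) (hJ1 : AtomFreeBlowupIsTame) (hU :
NoSupercriticalTameScar) (hT : NoLitInvisibleTransient)
(hG : LitCriticalSingularityIsTypeI) (hD : NoDarkBall) : NavierStokesRegularity` — SEVEN binders,
all consumed (= lens `closes_N1`): N1's `RootDecompTerminalEnergy.closes`
takes P1, P2, J1 and E₂; E₂ is rebuilt at a tame first blow-up from its backward-singular vertex xs
(landed `terminalTrace_blowupHasSingularPoint_proof`, 18382):
D makes xs lit, U bounds its scar, T₃ᴸ its budget, xs is not backward bounded (ess-sup on backward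
cylinders), so G₂ᴸ gives Type I.

DEPENDENCY SHAPE. Kernel accounting (lens, all sorry-free): S ⟺ P1 ∧ P2 ∧ J1 ∧ U ∧ T₃ᴸ ∧ G₂ᴸ ∧ D
given N1's S ⟹ P1 ∧ P2 ∧ J1 (`root_iff_pieces_N1`, EXACT);
E₂ ⟺ U ∧ T₃ᴸ ∧ T₃ᴰ ∧ G₂ᴸ ∧ G₂ᴰ (`noTameTypeII_iff_litDarkCells`, EXACT AT THE RESIDUAL); D ⟹ T₃ᴰ ∧
Gᴰ ∧ G₂ᴰ (`darkCells_of_noDarkBall`, vacuity);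
D ⟸ D₁ ∧ D₂, D ⟹ D₂; every piece S-necessary by vacuity (`cells_of_root`, `darkPieces_of_root`).
Each new piece strictly WEAKER than S (vacuity; separating
class of D = every LIT blow-up model: Type-I self-similar/DSS profiles, Tao's averaged cascade with
visibility order ≈ 1/50, Hou–Luo numerics — all satisfy D's
analogue and violate S's); T₃ᴸ, G₂ᴸ WEAKER than T₃, G₂ by restriction and ≡ them GIVEN D (declared,
not sold as progress).
THE LEVER (why the carving is not a costume). Every NSI blow-up IN PRINT is DARK at every vertex —
globally energy-extinct at the singular time (Scheffer 1985/87;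
Ożański arXiv:1709.00602 p.6; Ożański CMP 374 (2020) Thm 1.7 «arbitrary energy profile» REQUIRES
e(t) → 0, [corpus:paper-arxiv-1809.02109 p.5 Thm 1.7, p.13
Prop 5.1]); a LIT NSI blow-up needs a live cascade superposed with live remnants, outside Ożański's
«substitute for linearity» [corpus:paper-arxiv-1809.02109 p.9]
— not in print (census test T-lit-NSI). So the lineage's «NSI-LOADED» certificates for T₃ / G₂'s
caricature become «DARK-ONLY» certificates, and the dark cells are
emptied by an expected THEOREM of the Navier–Stokes EQUATION (backward uniqueness + space-like
unique continuation — exactly the catalogued evasions of the NSI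
barriers), with the engine landed.

PIECE TAGS (census HOME/census/COSTUME-CENSUS-v4.md sha256 e828b187… (census g4 final, bus
06:16:10Z; rows for lens-6 g3/g4/g5: TerminalScar, ParabolicBudget, BernoulliBudget K19 RETIRED);
HOME/census/bernoulli/j338635 (K19 packet profiles; instrument T-order requested); critic
CRITIC-LEDGER rows 31 (g3), 48 (g4 ParabolicBudget CLEARED), 63 (g6 LitSlice CLEARED); node card
HOME/decomp-ns-lens-6/NODE-g6.md sha256
af3930eded50a4e19d62eb3b6c82fb82eed31bf83127c6129a0498c02d60836d (131 lines); probes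
HOME/decomp-ns-lens-6/bc/LitSliceProbe{1,2,3}.lean + .verdicts.txt (D, D₁, D₂ CLEAN all batteries;
T₃ᴸ, G₂ᴸ, Gᴸ CLEAN [timeouts: P3]; P5 C → S never closed) — re-probed by the writer at batteryMs
90000 (litslice/bc/Probe.out.txt)).
- D `NoDarkBall` [crux r3 · NEW · TAME-FREE · WEAKER than S (vacuity) · ATTACKABLE NOW — FIRST
PROVER TARGET (BC3 skeleton `NoDarkBall_of : DarkBallSpreads →
  NoGlobalExtinction → NoDarkBall`; BC5 rung = the PROVED engine plug
`curl_eq_zero_of_extinct_of_farField`) · OUTSIDE every relaxation barrier (the NSI witnesses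
  VIOLATE D: they are dark) · not `LocalIrrotationalScarDoor` (that door needs space–time Type I and
a profile trace; D is rate-free, about u(T) itself)].
- T₃ᴸ `NoLitInvisibleTransient` [crux r2 · NEW · DECLARED RESIDUAL · WEAKER than T₃ (restriction), ≡
T₃ GIVEN D · NSI-UNCERTIFIED after the carving (every
  printed NSI witness is dark; re-certification = T-lit-NSI) · Tao-VACUOUS (the averaged blow-up is
supercritically scarred: U's cell) · IDEA-NEEDED (a lower
  bound on the visibility order N(x₀) = liminf log∫_{B_r}|u(T)|²/log r of a lit tame transient) ·
INSTRUMENTABLE (N(x₀), budget A(r) on candidate profiles)].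
- G₂ᴸ `LitCriticalSingularityIsTypeI` [crux r4 · NEW · WEAKER than G₂ (restriction), ≡ G₂ GIVEN D ·
ATTACKABLE-BY-INHERITANCE through the Liouville door:
  skeleton `LitCriticalSingularityIsTypeI_of : ScaledBoundsOfBudget → AncientOfEnergyTypeI →
VorticityPace.Liouville → G₂ᴸ` (Seregin 2007 scaled-energy
  equivalence; Seregin–Šverák 2009 / KNSS 2009 energy-Type-I zoom; (L) = stmt-10551 open) ·
BARRIER-FREE w.r.t. both relaxation barriers (its dark caricature
  = Scheffer's Type-I-rate cascade sits in G₂ᴰ ⟸ D)].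
- U `NoSupercriticalTameScar` [crux r5 · g4 VERBATIM (ParabolicBudget, CLEARED row 48, never booked)
· DECLARED RESIDUAL (second) · BARRIER: Tao-LOADED (the
  averaged cascade is tame-compatible and supercritically scarred, N ≈ 1/50) · unchanged by g6 (dark
⟹ scar 0)].
- P1/P2/J1: N1's items verbatim (P1 the shared BLOCKER 1217; P2 CKN-provable M; J1 N1's residual).
Asides (outside the cone, never staffed): D₁, D₂ (D's stubs;
  provers on D land them `--supports`), T₃ᴰ, G₂ᴰ (dark cells, ⟸ D by vacuity — the MODEL-INHABITED
cells: printed NSI cascades, NS-empty by D).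
- COSTUME: none (strip the vocabulary: D is not a regularity criterion — it forbids one
terminal-slice configuration; the residual T₃ᴸ ∧ G₂ᴸ is declared ≡ T₃ ∧ G₂
  mod D; not g3's quiet/extinct axis — g3/g4/g5 certified cells BY the dark witnesses, g6 types that
darkness is NS-impossible).
LEAF TAGS. ATTACKABLE NOW: D (via D₂ engine landed + plugged, D₁ EFV/CKN), P2. IDEA-NEEDED: T₃ᴸ
(visibility-order lever), G₂ᴸ's (L). INSTRUMENTABLE: T-dark-NS,
T-order, T-lit-NSI (card §Tests). BARRIER: U (Tao-LOADED), J1/P1 as in N1.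

Rationale: WHY THIS LINE. N1 reduced Clay (A) to P1 ∧ P2 ∧ J1 ∧ E₂ (E₂ = «tame first blow-ups are Type I»);
lens-6 g4 (ParabolicBudget, CLEARED row 48) cut E₂ ⟺ U ∧ T₃ ∧ G₂
by the terminal scar / parabolic budget at the backward-singular vertex, certifying U Tao-LOADED and
T₃ NSI-Type-II-LOADED, G₂ idea-needed with Scheffer's cascade
as caricature; g5 (BernoulliBudget) tried to split the loaded region by the pressure sign and census
K19 retired that axis. g6 asks WHERE on the terminal slice the
NSI witnesses that load T₃ and G₂'s caricature actually sit — and finds them all DARK (globally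
energy-extinct at T₀: Scheffer; Ożański arXiv:1709.00602 p.6,
arXiv:1809.02109 Thm 1.7 / Prop 5.1), i.e. in cells that the Navier–Stokes equation should empty by
backward uniqueness across the extinct slice (ESS 2003 /
GKP 2016 — LANDED in the tree as
`Literature.Analysis.FluidPDE.IsClassicalNSSolutionOn.curl_eq_zero_of_farField_of_tendsto`) plus
space-like unique continuation from a dark ball through the connected regular part of the singular
slice (CKN
H¹-nullity; EFV 2006 doubling / two-sphere one-cylinder, arXiv:math/0611462 Thm 2; Vessella
arXiv:0710.2192) — in print only the Type-I-conditional slice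
statement exists (Albritton–Barker ARMA 2019 Cor 1.8, [corpus:paper-arxiv-1802.03164 p.6]; Seregin
2014 Lecture Notes §6.6 pp.127–129 prints the D₂ argument
pattern for zoom limits). Imported: unique continuation for parabolic equations (Carleman /
frequency-function doubling), partial regularity (CKN slice
nullity), backward uniqueness in exterior domains. Sources: HOME/decomp-ns-lens-6/LitSlice.lean
sha256 6c6e56dc3c387250e23dfaab2d9d1e804e352d31846e24000abda897867b5afb (821 lines; lean rc 0 / 0
err / 0 warn / 0 sorry per lens-6 g6 + critic row 63; statements extracted verbatim by regex in
litslice/spec.py); HOME/decomp-ns-lens-6/NODE-g6.md sha256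
af3930eded50a4e19d62eb3b6c82fb82eed31bf83127c6129a0498c02d60836d (131 lines).
RANKED CRUXES. r2 T₃ᴸ `NoLitInvisibleTransient` (declared residual; hardest: no equation-level lower
bound on the visibility order of a lit tame transient is known);
r3 D `NoDarkBall` (first prover target; theorem-grade); r4 G₂ᴸ `LitCriticalSingularityIsTypeI`
(Liouville door; (L) open); r5 U `NoSupercriticalTameScar` (g4 cell,
Tao-LOADED, second residual); r6 P2, r7 J1, r8 P1 (N1 verbatim, dedup).
KILL CRITERIA. D refuted ⟺ a first blow-up whose terminal slice vanishes a.e. on a ball while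
staying singular — would kill D and re-load T₃ᴰ/G₂ᴰ NS-side (no model,
NS or NSI-free, known; every numerical candidate is lit). T₃ᴸ refuted-substantive: a lit
self-erasing Type-II transient (supercritical energy sweeping B_r(x₀) ×
(T−r²,T) at every scale, faint non-zero trace at T, visibility order in (1,∞)) — kills T₃ᴸ, T₃, E₂
and N1's line with it. G₂ᴸ refuted: a lit «breather»
(sup|u|√(T−t) unbounded along a sequence while the budget stays bounded) — kills G₂ too. U refuted ⟺
a tame blow-up with a supercritical terminal scar (Tao's
cascade made exact) — kills E₂. COLLAPSE: to N1 if D is provable only through S (vacuity) — excluded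
in spirit by the landed engine doing real work in the rung.
NOT DECOMPOSED YET. T₃ᴸ (declared residual; instrument only: visibility order); U (Tao-LOADED,
residual); D beyond D₁/D₂ (D₁'s support lemma: the summed-Carleman
vector version of EFV for the vorticity system |∂ₜωᵢ − νΔωᵢ| ≤ M(|ω| + |∇ω|) — printed for scalar
equations, folklore for diagonal systems); G₂ᴸ beyond its
zoom + (L) skeleton; P2/J1/P1 laddered in N1's lineage (N4/N10/N14/N15 under P1).
CHEAPEST FALSIFIER. T-dark-NS (census, cheap): every numerical NS/Euler blow-up candidate of record
(Luo–Hou 2014, Hou 2022, Kerr, reconnection runs K9/K13/K14) is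
LIT at the candidate singular point — expected YES, with visibility order N = 3 − 2a from the fitted
profile exponent; T-order on the K19 packet profiles (bounded
scar ⟹ N ≥ 1). Decisive for the barrier reach (literature/construction): T-lit-NSI — does a weak NSI
solution exist that blows up at (x₀,T₀) with u(T₀) ≠ 0 on
every ball around x₀? YES re-loads T₃ᴸ; NO-in-principle confines the NSI barrier to dark cells for
every terminal-slice carving.

Novelty: Searches (lens-6 g6 2026-08-30, both corpora; re-read by the writer): tree `rg "u T x =
0|extinct|dark|vanish.*ball.*T"` over Theses/Theorems/Cruxes of the
summit → only g3's `extinct_*` census lemmas (HOME TerminalScar.lean:648–668), the NoTerminalJolt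
line's `jolt_of_terminalValue_eq_zero` (extinct terminal value
⟹ energy jolt; J1-side) [tree Cruxes/NoTerminalJolt/Lines/regular_split.md:164],
PowerGaugeEulerLiouville's `extinct_trace` stratum (zoom-limit class) and
`LocalIrrotationalScarDoor` (PROVED; space–time Type-I + profile-trace door) — no item states «no
dark ball at the lifespan», no born node N1–N15 uses the
dark/lit bit as a carving axis (critic rows 1–69 read). Corpus fts+vec: «unique continuation final
time Navier–Stokes vanish open set» → Albritton–Barker ARMA
2019 Cor 1.8 [corpus:paper-arxiv-1802.03164 p.6]: rescaled terminal slice ⇀* 0 at x* ⟹ regular at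
x*, ONLY under sup_n ‖v(t_n)‖ in Ḃ^{-1+3/p}_{p,∞} < ∞
(Type-I-like), proof at a REGULAR time via ESS Thm 4.1 [p.28]; «two-sphere one-cylinder / doubling
caloric» → EFV 2006 Thm 2 [corpus:paper-arxiv-math_0611462
p.4], Vessella survey [corpus:paper-arxiv-0710.2192], applied to NS only at regular times in print
[corpus:paper-arxiv-1812.10246 p.3]; Albritton–Barker local
Type I [corpus:paper-arxiv-1811.00502 p.9 Thm 4.1] is a Liouville theorem, not a slice statement.
Corpus hybrid «Navier–Stokes blow-up time velocity vanishes
open set unique continuation final time» → Seregin 2014 Lecture Notes §6.6 [corpus:book  [refs: 1709.00602, paper-arxiv-1802.03164, paper-arxiv-math_0611462, paper-arxiv-0710.2192, paper-arxiv-1812.10246, paper-arxiv-1811.00502, book-seregin2014-lecture-notes-regularity-theory-navier-stokes-equations, paper-arxiv-1809.02109]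

Barriers (technique_class: lit-dark terminal carving; GKP extinction plug; EFV doubling): - technique_class: lit-dark terminal carving; GKP extinction plug; EFV doubling (unique continuation
/ backward uniqueness for the vorticity equation, CKN
  slice nullity, blow-up zoom + Liouville for G₂ᴸ).
- Literature.Barriers.NavierStokesRegularity.NSITypeIIBlowup: D — OUTSIDE the class («arguments
valid for every weak NSI solution»): D's proof uses backward
  uniqueness + space-like unique continuation of the vorticity EQUATION (the catalogued evasions)
and the NSI witnesses VIOLATE D's conclusion (they are dark —
  the point of the carving). T₃ᴸ — INSIDE the class as typed (local-energy currency) but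
NSI-UNCERTIFIED: every printed witness is dark, hence in T₃ᴰ ⟸ D;
  declared RESIDUAL; the bet is T-lit-NSI = NO or a visibility-order lever using the equation. G₂ᴸ —
barrier-free (its Type-I-rate caricature, Scheffer's
  cascade, is dark: G₂ᴰ ⟸ D). U — vacuous (dark ⟹ scar 0; U's separating class is Tao's, below).
- Literature.Barriers.NavierStokesRegularity.NavierStokesInequalitySingularSolutionNarrow (and the
Cantor-switching family, file
  Literature/Barriers/NavierStokesRegularity/NavierStokesInequalityCantorSwitching.lean): same
placement — all such solutions are energy-extinct at the singular
  time [arXiv:1709.00602 p.6; corpus:paper-arxiv-1809.02109 p.5/p.13]; proposed scope caveat filed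
by lens-6 (NOTES `## Barrier notes`): NSI witnesses load only
  DARK sub-cells of any terminal-slice carving.
- Literature.Barriers.NavierStokesRegularity.TaoAveragedBlowup: D — out

History (route lifecycle, newest last):
- 2026-08-30T09:40:14Z · rev 2: informal re-worded for NoSupercriticalTameScar_of_cells (planner-decomp-ns-writer-1-g4-0)
- 2026-08-31T13:39:49Z · rev 5: informal re-worded for ScarModulusTradeoff (planner-decomp-ns-writer-1-g32-0)
- 2026-08-31T13:41:28Z · rev 6: informal re-worded for ScarModulusTradeoff (planner-decomp-ns-writer-1-g32-0)
- 2026-08-31T17:58:45Z · rev 7: informal re-worded for CritTameScarIsCritical (planner-decomp-ns-writer-1-g36-0)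

sub-problem: NavierStokesRegularity · status: draft · opened planner-decomp-ns-writer-1-g3-0 2026-08-30T06:41:59Z · rev 7 · ledger route-NavierStokesRegularity-RootDecompLitSlice
GENERATED by the gate from the ledger (D-0016/17). Provers cite these decls: `theorem foo : Summit.NavierStokesRegularity.NavierStokesRegularity.Theses.RootDecompLitSlice.<Decl> := …` in Summits/NavierStokesRegularity/NavierStokesRegularity/Theorems/<Name>.lean.
-/

namespace Summit.NavierStokesRegularity.NavierStokesRegularity.Theses.RootDecompLitSlice

open scoped BigOperators Topology Manifold Classical MeasureTheory ProbabilityTheory Matrix InnerProductSpace ComplexConjugate ContinuousMap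
open Filter Set Function TopologicalSpace MeasureTheory

attribute [summit_statement] _root_.NavierStokesRegularity

open Literature.NS

/-- item stmt-NavierStokesRegularity-29562 · crux · rank 2 · open · by planner
why it might fail: a lit self-erasing Type-II transient — supercritical energy sweeping B_r(x₀)×(T−r²,T) at every scale, leaving a faint non-zero trace at T (visibility order in (1,∞)) — is tame and boundedly scarred
sources: arXiv:1709.00602, arXiv:1809.02109, CKN1982, LeslieShvydkoy2017, Seregin2014, arXiv:1402.0290
[crux] T₃ᴸ NO LIT INVISIBLE TRANSIENT (lens-6 g6; node N16 under N1's residual E₂ =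
RootDecompTerminalEnergy.NoTameTypeII stmt-24828; DECLARED RESIDUAL): for a maximal smooth solution
with lifespan T, Leray–Hopf from a rapidly decaying datum, TAME at T (u(t) → u(T) in L²), at every
LIT vertex x₀ (u(T) vanishes a.e. on no ball around x₀) whose terminal scar r⁻¹∫_{B_r}|u(T)|² is
bounded, the parabolic budget sup_{t∈(T−r²,T)} r⁻¹∫_{B_r}|u(t)|² is bounded [tag WEAKER than g4's T₃
(restriction) and than S (vacuity); ≡ T₃ GIVEN D (kernel T₃ ⟺ T₃ᴸ ∧ T₃ᴰ, D ⟹ T₃ᴰ) · NSI-UNCERTIFIED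
after the carving (every printed NSI witness is dark) · Tao-VACUOUS · IDEA-NEEDED (visibility-order
lower bound) · INSTRUMENTABLE · never a prover target before an idea lands] -/
@[route_item "route-NavierStokesRegularity-RootDecompLitSlice", crux]
def NoLitInvisibleTransient : Prop :=
  ∀ (ν T : ℝ), 0 < ν → 0 < T → ∀ (u : ℝ → EuclideanSpace ℝ (Fin 3) → EuclideanSpace ℝ (Fin 3)) (p : ℝ → EuclideanSpace ℝ (Fin 3) → ℝ), Literature.Analysis.FluidPDE.IsMaximalSmoothSolution ν 0 u p T → Literature.Analysis.FluidPDE.IsLerayHopfOn T ν 0 (u 0) u → Literature.Analysis.FluidPDE.HasRapidSpatialDecay (u 0) → Filter.Tendsto (fun t => MeasureTheory.eLpNorm (u t - u T) 2 MeasureTheory.volume) (nhdsWithin T (Set.Iio T)) (nhds 0) → ∀ x₀ : EuclideanSpace ℝ (Fin 3), ¬ (∃ ρ : ℝ, 0 < ρ ∧ ∀ᵐ x ∂(MeasureTheory.volume.restrict (Metric.ball x₀ ρ)), u T x = 0) → (∃ M r₁ : ℝ, 0 < r₁ ∧ ∀ r ∈ Set.Ioo 0 r₁, r⁻¹ * ∫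 x in Metric.ball x₀ r, ‖u T x‖ ^ 2 ≤ M) → ∃ M r₀ : ℝ, 0 < r₀ ∧ ∀ r ∈ Set.Ioo 0 r₀, ∀ t ∈ Set.Ioo (T - r ^ 2) T, r⁻¹ * ∫ x in Metric.ball x₀ r, ‖u t x‖ ^ 2 ≤ M

/-- item stmt-NavierStokesRegularity-29563 · crux · rank 3 · closed · proved by Summit.NavierStokesRegularity.NavierStokesRegularity.Theorems.noDarkBall (planner) · by planner
why it might fail: only if slice unique continuation broke at the boundary of the regular region — a blow-up whose vorticity support at time T retreats from a ball while staying singular on its rim (no model, NS or NSI-free, known)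
sources: arXiv:math/0611462, EscauriazaSereginSverak2003, GKP2016, CKN1982, arXiv:1802.03164, arXiv:1809.02109
[crux] D NO DARK BALL ON THE TERMINAL SLICE OF A FIRST BLOW-UP (lens-6 g6; NEW; TAME-FREE; FIRST
PROVER TARGET): for a maximal smooth solution with lifespan T, Leray–Hopf on [0,T] from a rapidly
decaying datum, the terminal slice u(T) (pinned a.e. by weak L²-continuity) does not vanish a.e. on
any ball [tag WEAKER than S (vacuity; separating class: every LIT blow-up model) · EVICTS every
printed NSI blow-up (all energy-extinct at T₀) from the lineage's cells · ATTACKABLE NOW: BC3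
skeleton NoDarkBall_of : DarkBallSpreads → NoGlobalExtinction → NoDarkBall (kernel = lens
`noDarkBall_of_spreads`); engines: CKN slice nullity, EFV two-sphere one-cylinder at regular slice
points, harmonic identity theorem, a.e.-ray GMT (D₁); far-field bounds + LANDED
`IsClassicalNSSolutionOn.curl_eq_zero_of_farField_of_tendsto` + L² Liouville + extension by zero
(D₂; plug PROVED = BC5 rung `curl_eq_zero_of_extinct_of_farField`)] -/
@[route_item "route-NavierStokesRegularity-RootDecompLitSlice", crux]
def NoDarkBall : Prop :=
  ∀ (ν T : ℝ), 0 < ν → 0 < T → ∀ (u : ℝ → EuclideanSpace ℝ (Fin 3) → EuclideanSpace ℝ (Fin 3)) (p : ℝ → EuclideanSpace ℝ (Fin 3) → ℝ), Literature.Analysis.FluidPDE.IsMaximalSmoothSolution ν 0 u p T → Literature.Analysis.FluidPDE.IsLerayHopfOn T ν 0 (u 0) u → Literature.Analysis.FluidPDE.HasRapidSpatialDecay (u 0) → ∀ (x₀ : EuclideanSpace ℝ (Fin 3)) (ρ : ℝ), 0 < ρ → ¬ (∀ᵐ x ∂(MeasureTheory.volume.restrict (Metric.ball x₀ ρ)),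 u T x = 0)

-- `NoDarkBall` holds: proved by `Summit.NavierStokesRegularity.NavierStokesRegularity.Theorems.noDarkBall` (its module imports this route file, so no `_holds` link can be stated here).

/-- item stmt-NavierStokesRegularity-29564 · crux · rank 4 · open · by planner
why it might fail: a lit «breather» (sup|u|√(T−t) unbounded along a sequence while the budget stays bounded) is tame, budget-critical, singular, lit and Type II; (L) itself is open
sources: arXiv:2006.04140, Seregin2014, SereginSverak2009, KochNadirashviliSereginSverak2009, arXiv:1705.04420, BarkerPrange2021
[crux] G₂ᴸ A TAME BLOW-UP WITH A LIT PARABOLICALLY CRITICAL SINGULAR VERTEX IS TYPE I (lens-6 g6;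
the E₂-pure lit form of g4's G₂): a maximal smooth solution with lifespan T, Leray–Hopf from a
rapidly decaying datum, tame at T, possessing a LIT vertex with bounded parabolic budget that is not
backward bounded, blows up at the Type-I rate [tag WEAKER than G₂ (restriction) and than S
(vacuity); ≡ G₂ GIVEN D (G₂ ⟺ G₂ᴸ ∧ G₂ᴰ, D ⟹ G₂ᴰ) · ATTACKABLE-BY-INHERITANCE through the Liouville
door: BC3 skeleton LitCriticalSingularityIsTypeI_of : ScaledBoundsOfBudget (Seregin 2007: A-bounded
⟹ C, E bounded at the vertex) → AncientOfEnergyTypeI (Seregin–Šverák 2009 / KNSS: an energy-Type-I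
vertex that is not backward bounded zooms to a bounded ancient mild solution with a
non-a.e.-constant slice) → VorticityPace.Liouville (stmt-10551, open) → G₂ᴸ (vacuity: no such
vertex) · IDEA-NEEDED beyond (L) (energy-Type-I ⟹ rate-Type-I at a vertex; Seregin 2014 Prop. 3.11
gives only the converse) · BARRIER-FREE (its dark caricature, Scheffer's Type-I-rate cascade, sits
in G₂ᴰ)] -/
@[route_item "route-NavierStokesRegularity-RootDecompLitSlice", crux]
def LitCriticalSingularityIsTypeI : Prop :=
  ∀ (ν T : ℝ), 0 < ν → 0 < T → ∀ (u : ℝ → EuclideanSpace ℝ (Fin 3) → EuclideanSpace ℝ (Fin 3)) (p : ℝ → EuclideanSpace ℝ (Fin 3) → ℝ), Literature.Analysis.FluidPDE.IsMaximalSmoothSolution ν 0 u p T → Literature.Analysis.FluidPDE.IsLerayHopfOn T ν 0 (u 0) u → Literature.Analysis.FluidPDE.HasRapidSpatialDecay (u 0) → Filter.Tendsto (fun t => MeasureTheory.eLpNorm (u t - u T) 2 MeasureTheory.volume) (nhdsWithin T (Set.Iio T)) (nhds 0) → (∃ x₀ : EuclideanSpace ℝ (Fin 3), ¬ (∃ ρ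 : ℝ, 0 < ρ ∧ ∀ᵐ x ∂(MeasureTheory.volume.restrict (Metric.ball x₀ ρ)), u T x = 0) ∧ (∃ M r₀ : ℝ, 0 < r₀ ∧ ∀ r ∈ Set.Ioo 0 r₀, ∀ t ∈ Set.Ioo (T - r ^ 2) T, r⁻¹ * ∫ x in Metric.ball x₀ r, ‖u t x‖ ^ 2 ≤ M) ∧ ¬ (∃ r > 0, ∃ C : ℝ, ∀ t ∈ Set.Ioo (T - r ^ 2) T, ∀ x ∈ Metric.ball x₀ r, ‖u t x‖ ≤ C)) → Literature.Analysis.FluidPDE.IsTypeIBlowup u T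

/-- item stmt-NavierStokesRegularity-29565 · crux · rank 5 · SPLIT (gen 1) into CritTameScarIsCritical, AbruptTameScarIsCritical + glue NoSupercriticalTameScar_of_cells · direct attempts still welcome (low priority) · by planner
why it might fail: a tame blow-up whose terminal slice carries a supercritical scar |u(T,x)| ~ |x−x₀|^{-a}, a > 1 (Tao's averaged cascade made exact: N ≈ 1/50) — tame, lit, scar unbounded
sources: arXiv:1402.0290, LeslieShvydkoy2017, CKN1982, arXiv:1709.00602
[crux] U NO SUPERCRITICAL TAME SCAR (lens-6 g4 ParabolicBudget piece VERBATIM, CLEARED critic row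
48, first birth here; DECLARED RESIDUAL — Tao-LOADED): for a maximal smooth solution with lifespan
T, Leray–Hopf from a rapidly decaying datum, tame at T, the terminal scar r⁻¹∫_{B_r(x₀)}|u(T)|² is
bounded as r ↓ 0 at every vertex x₀ [tag WEAKER than E₂ (Type I ⟹ budget ⟹ scar, Leslie–Shvydkoy
landed; kernel `noSupercriticalTameScar_of_noTameTypeII`) and than S (vacuity) · unchanged by g6 (a
dark vertex has scar 0, `scar_of_dark`: U's separating class is lit already) · BARRIER: LOADED by
Tao's averaged cascade (tame-compatible, supercritically scarred, visibility order ≈ 1/50) — any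
proof must use the exact u·∇u algebra · never a prover target before an idea lands] -/
@[route_item "route-NavierStokesRegularity-RootDecompLitSlice", crux]
def NoSupercriticalTameScar : Prop :=
  ∀ (ν T : ℝ), 0 < ν → 0 < T → ∀ (u : ℝ → EuclideanSpace ℝ (Fin 3) → EuclideanSpace ℝ (Fin 3)) (p : ℝ → EuclideanSpace ℝ (Fin 3) → ℝ), Literature.Analysis.FluidPDE.IsMaximalSmoothSolution ν 0 u p T → Literature.Analysis.FluidPDE.IsLerayHopfOn T ν 0 (u 0) u → Literature.Analysis.FluidPDE.HasRapidSpatialDecay (u 0) → Filter.Tendsto (fun t => MeasureTheory.eLpNorm (u t - u T) 2 MeasureTheory.volume) (nhdsWithin T (Set.Iio T)) (nhds 0) → ∀ x₀ : EuclideanSpace ℝ (Fin 3), ∃ M r₁ : ℝ, 0 < r₁ ∧ ∀ r ∈ Set.Ioo 0 r₁, r⁻¹ * ∫ x in Metric.ball x₀ r, ‖u T x‖ ^ 2 ≤ M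

-- parent: NoSupercriticalTameScar · child (gen 1)
/--     item stmt-NavierStokesRegularity-31733 · crux · rank 501 · closed · proved by Summit.NavierStokesRegularity.NavierStokesRegularity.Theorems.CritTameScarIsCriticalClosed.critTameScarIsCritical_proof (prover)
    parent: NoSupercriticalTameScar · by planner
    why it might fail: A critically tame Type-II blow-up (clock b ∈ [1/2,2/3)) freezing a scar of order N ∈ [4/5,1), e.g. |u(T,x)| ~ |x−x₀|^{-11/10}, refutes it — no model known, NS or averaged; Type-I profiles give N = 1; the trade-off caps at N = 4b/(b+2) < 1 for b < 2/3 (HV♯: N ≥ 4/5; N = 1/2 enemy dead mod STg).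
    sources: Tao2016AveragedNS, arXiv:1709.00602, LeslieShvydkoy2017, arXiv:1811.00502, CKN1982, SereginSverak2009
[crux · Uᶜ «A CRITICALLY TAME BLOW-UP HAS CRITICAL SCARS» · child 1 of the GLUED SPLIT (gen 1) of U
`NoSupercriticalTameScar` ⟨29565⟩ (N16 `RootDecompLitSlice` crux r5 = declared residual of record,
shared with N20): U ⟺ Uᶜ ∧ Uᵃ EXACT in kernel (`LitSlice.noSupercriticalTameScar_iff_cells`,
by_cases on the CLOCK predicate CritTame u T := ∃ K T₁<T, ∀ t ∈ (T₁,T), ∫⁻|u t − u T|ₑ² ≤ K√(T−t) —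
the exact rate of every (D)SS collapse; lintegral currency; scale-invariant); lens-6 g8 «THE
PARABOLIC CLOCK». AFTER g36 (critic rows 631/636/639): ST ⟨31791⟩, STg ⟨27390⟩, HV ⟨31792⟩ (N ≥
1/2), HV♯ ⟨27391⟩ (N ≥ 4/5 = the LANDED BC5 rung), aside ⟨27392⟩ CLOSED proved. Grade a solution by
the clock exponent b and the ENERGY exponent a (‖u(t)‖₂²−‖u(T)‖₂² ≤ C(T−t)^a): scar law α(a,b) =
2b/(1+b−a) (`EnergyClockScarLaw.energyClockScarRung`), a = b/2 free (`energyLaw_of_clock`), the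
free-window method closes EXACTLY {a+b ≥ 1} (`criticalScar_of_energyClock`), a is Leray-capped at
1/2 (`no_energyLaw_above_half`), b ≤ 1 (`no_clock_above_one`). OPEN CONTENT after g36 = first
blow-ups on the critical-clock window b ∈ [1/2,2/3) whose energy exponent stays below 1−b (at b =
1/2: a ∈ [1/4,1/2) — SUPER-LERAY dis -/
@[route_item "route-NavierStokesRegularity-RootDecompLitSlice"]
def CritTameScarIsCritical : Prop :=
  ∀ (ν T : ℝ), 0 < ν → 0 < T → ∀ (u : ℝ → EuclideanSpace ℝ (Fin 3) → EuclideanSpace ℝ (Fin 3)) (p : ℝ → EuclideanSpace ℝ (Fin 3) → ℝ), Literature.Analysis.FluidPDE.IsMaximalSmoothSolution ν 0 u p T → Literature.Analysis.FluidPDE.IsLerayHopfOn T ν 0 (u 0) u → Literature.Analysis.FluidPDE.HasRapidSpatialDecay (u 0) → Filter.Tendsto (fun t => MeasureTheory.eLpNorm (u t - u T) 2 MeasureTheory.volume) (nhdsWithin T (Set.Iio T)) (nhds 0) → (∃ K T₁ : ℝ, T₁ < T ∧ ∀ t ∈ Set.Ioo T₁ T, ∫⁻ x, ‖u t x - u T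 x‖ₑ ^ 2 ≤ ENNReal.ofReal (K * Real.sqrt (T - t))) → ∀ x₀ : EuclideanSpace ℝ (Fin 3), ∃ M r₁ : ℝ, 0 < r₁ ∧ ∀ r ∈ Set.Ioo 0 r₁, r⁻¹ * ∫ x in Metric.ball x₀ r, ‖u T x‖ ^ 2 ≤ M

-- `CritTameScarIsCritical` holds: proved by `Summit.NavierStokesRegularity.NavierStokesRegularity.Theorems.CritTameScarIsCriticalClosed.critTameScarIsCritical_proof` (its module imports this route file, so no `_holds` link can be stated here).

-- parent: NoSupercriticalTameScar · child (gen 1)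
/--     item stmt-NavierStokesRegularity-31734 · crux · rank 502 · open
    parent: NoSupercriticalTameScar · by planner
    why it might fail: This is where Tao's mechanism lives: an abrupt NS cascade parking a fixed fraction of eₙ at scale λₙ⁻¹ with eₙλₙ → ∞ violates it; only the finer structure of the NS bilinear form (not shared by averaged equations) can exclude it.
    sources: Tao2016AveragedNS, arXiv:1709.00602, arXiv:1811.00502, SereginSverak2009, Hou2022PotentiallySingularNS
[crux · Uᵃ «AN ABRUPTLY TAME BLOW-UP HAS CRITICAL SCARS» · NEW · child 2 of the GLUED SPLIT (gen 1)
of U `NoSupercriticalTameScar` stmt-NavierStokesRegularity-29565 (N16 `RootDecompLitSlice` crux r5 =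
declared residual of record, shared with N20 `RootDecompMorreyBudget`; never refined since g3) =
lens-6 g8 «THE PARABOLIC CLOCK» (HOME/decomp-ns-lens-6/ParabolicClock.lean sha256 2cde2246…, 1307
lines, lean rc 0 / 0 sorry, axioms std; NODE-g8.md; CRITIC-LEDGER row 88 CLEARED): U ⟺ Uᶜ ∧ Uᵃ EXACT
in kernel (`noSupercriticalTameScar_iff_cells`; glue `N16_noSupercriticalTameScar_of_cells`,
by_cases on the CLOCK predicate CritTame u T := ∃ K T₁<T, ∀ t ∈ (T₁,T), ∫⁻|u t − u T|ₑ² ≤ K√(T−t) —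
the L²-trajectory reaches its terminal value ON THE PARABOLIC CLOCK; lintegral currency, no Bochner
junk; scale-invariant; the exact rate of every (D)SS collapse). Why novel: the first node that
grades Type-II TAMENESS by a clock rather than by the sup-rate or the energy curve's Hölder law: the
critically-tame half Uᶜ is Tao/NSI-II-VACUOUS BY CONSTRUCTION (both cascades are abruptly tame) and
carries a theorem-grade rung (HV: scar order N ≥ 1/2 via the scar–modulus trade-off ST), the abrupt
half Uᵃ is whe -/
@[route_item "route-NavierStokesRegularity-RootDecompLitSlice"]
def AbruptTameScarIsCritical : Prop :=
  ∀ (ν T : ℝ), 0 < ν → 0 < T → ∀ (u : ℝ → EuclideanSpace ℝ (Fin 3) → EuclideanSpace ℝ (Fin 3)) (p : ℝ → EuclideanSpace ℝ (Fin 3) → ℝ), Literature.Analysis.FluidPDE.IsMaximalSmoothSolution ν 0 u p T → Literature.Analysis.FluidPDE.IsLerayHopfOn T ν 0 (u 0) u → Literature.Analysis.FluidPDE.HasRapidSpatialDecay (u 0) → Filter.Tendsto (fun t => MeasureTheory.eLpNorm (u t - u T) 2 MeasureTheory.volume) (nhdsWithin T (Set.Iio T)) (nhds 0) → ¬ (∃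 K T₁ : ℝ, T₁ < T ∧ ∀ t ∈ Set.Ioo T₁ T, ∫⁻ x, ‖u t x - u T x‖ₑ ^ 2 ≤ ENNReal.ofReal (K * Real.sqrt (T - t))) → ∀ x₀ : EuclideanSpace ℝ (Fin 3), ∃ M r₁ : ℝ, 0 < r₁ ∧ ∀ r ∈ Set.Ioo 0 r₁, r⁻¹ * ∫ x in Metric.ball x₀ r, ‖u T x‖ ^ 2 ≤ M

-- parent: NoSupercriticalTameScar · glue (gen 1)
/--     item stmt-NavierStokesRegularity-31735 · support · rank 503 · closed · proved by Summit.NavierStokesRegularity.NavierStokesRegularity.Theorems.LitSlice.noSupercriticalTameScar_of_cells_proof (prover)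
    parent: NoSupercriticalTameScar · GLUE: children ⟹ parent · by planner
[support · glue of the GLUED SPLIT (gen 1) of U NoSupercriticalTameScar 29565 on N16 = lens-6 g8
«THE PARABOLIC CLOCK» (CRITIC-LEDGER row 88 CLEARED; HOME/decomp-ns-lens-6/ParabolicClock.lean
sha256 2cde2246…)] Uᶜ → Uᵃ → U: EXACT in kernel (U ⟺ Uᶜ ∧ Uᵃ = noSupercriticalTameScar_iff_cells;
by_cases on the clock predicate CritTame u T). PROVED in the writer's evidence file
GlueProofN16U.lean (ClockGlue.glue_holds, axioms std) — landable now by any prover as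
Theorems/RootDecompLitSliceNoSupercriticalTameScar_of_cells.lean. Companion SUPPORT ITEMS on this
route (rank 9, theorem-grade): ST ScarModulusTradeoff stmt-NavierStokesRegularity-31791 (FIRST
PROVER TARGET; Hardy + energy identity + L²-geometry on the classical frame) and HV HalfVisibleScar
stmt-NavierStokesRegularity-31792 (BC5 rung of Uᶜ: scar order N ≥ 1/2 on the critically-tame class;
HV ⟸ ST kernel halfVisibleScar_of_tradeoff). Free normal forms for provers of T₃ᴸ 29562 / T₃: T₃ᴸ ⟺
T₃ᴸᵃ, T₃ ⟺ T₃ᵃ (abruptness may be assumed; lens noLitInvisibleTransient_iff_abrupt,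
noInvisibleTransient_iff_abrupt). -/
@[route_item "route-NavierStokesRegularity-RootDecompLitSlice"]
def NoSupercriticalTameScar_of_cells : Prop :=
  CritTameScarIsCritical → AbruptTameScarIsCritical → NoSupercriticalTameScar

-- `NoSupercriticalTameScar_of_cells` holds: proved by `Summit.NavierStokesRegularity.NavierStokesRegularity.Theorems.LitSlice.noSupercriticalTameScar_of_cells_proof` (its module imports this route file, so no `_holds` link can be stated here).

/-- item stmt-NavierStokesRegularity-24827 · crux · rank 6 · open · by planner
why it might fail: it should not — CKN partial regularity gives it; only the typed limsup/ball form could be mis-stated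
sources: CKN1982, arXiv:0709.3599
[crux] P2 — NO ENERGY ATOM AT A FRAME TIME [the ATTACKED cell; = registered stub `stub_noEnergyAtom`
of crux stmt-19625 (Cruxes/WeakLambdaCriterion/Lines/birth.lean) VERBATIM, reused not re-invented;
tag WEAKER(evidence: 0056 ⇒ P2 KERNEL `noEnergyAtom_of_typeIIEnergyEquality`; S ⇒ P2 KERNEL (critic
`noEnergyAtom_of_root`, writer `noEnergyAtom_of_noBlowup`); in-NS separating classes where P2 is a
THEOREM: rate β<3/5 `leslieShvydkoy2018_noConcentration_of_rate`, Type I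
`noEnergyAtom_of_isTypeIBlowup`, enstrophy α<4/5 `noEnergyAtom_of_enstrophyRate` — critic CLEARED
2026-08-30T01:32:55Z, CRITIC-LEDGER row 7); leaf ATTACKABLE-by-inheritance (LS18/CKN engine; open =
LS18 Question 1.1 at dimension 0, arXiv:1705.04420 p.4) + INSTRUMENTABLE (exponent test: an atom
needs sup-rate β ≥ 3/5 and core radius γ ≤ 2β/3; Tao band test); BC5 rung LANDED: Type-I case
`Theorems.NoTerminalJolt.noEnergyAtom_of_isTypeIBlowup`]: a classical NS solution on ℝ³×[0,T) (zero
force), Leray–Hopf on [0,T] from its rapidly decaying datum, deposits no energy atom at time T: ∀x₀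
∀η>0 ∃r>0, ∫_{B_r(x₀)}|u(t)|² < η for all t<T close to T. [difficulty: open-problem] -/
@[route_item "route-NavierStokesRegularity-RootDecompLitSlice", crux]
def NoEnergyAtom : Prop :=
  ∀ (ν T : ℝ), 0 < ν → 0 < T → ∀ (u : ℝ → EuclideanSpace ℝ (Fin 3) → EuclideanSpace ℝ (Fin 3)) (p : ℝ → EuclideanSpace ℝ (Fin 3) → ℝ), Literature.Analysis.FluidPDE.IsClassicalNSSolutionOn (Set.Ico 0 T) ν 0 u p → Literature.Analysis.FluidPDE.IsLerayHopfOn T ν 0 (u 0) u → Literature.Analysis.FluidPDE.HasRapidSpatialDecay (u 0) → ∀ (x₀ : EuclideanSpace ℝ (Fin 3)) (η : NNReal), 0 < η → ∃ r : ℝ, 0 < r ∧ ∀ᶠ t in nhdsWithin T (Set.Iio T), ∫⁻ x in Metric.ball x₀ r, ‖u t x‖ₑ ^ 2 < (η : ENNReal)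

/-- item stmt-NavierStokesRegularity-24829 · crux · rank 7 · open · by planner
why it might fail: a wild (non-L²-convergent) first blow-up without energy concentration at a point — energy escaping to a fractal terminal set (lens-5 Frostman axis)
sources: CKN1982, arXiv:2107.06509
[crux] J1 — AN ATOM-FREE FIRST BLOW-UP IS TAME [lens-2 J1 VERBATIM; RESIDUAL diffuse-dust cell; tag
WEAKER(evidence: E₁/18118 ⇒ J1 trivially, 0056 ⇒ J1 kernel via LS18 Thm 1.2 landed; separating
classes: atomic collapses and tame Type-II spikes, alive; omitted cell never constructed even in the
NSI relaxation — Scheffer/Ożański cascades are defect-free); leaf IDEA-NEEDED (GMT of the energy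
measure on the compact 𝓗¹-null singular slice Σ_T + dynamics; no named engine) — critic CLEARED
2026-08-30T01:32:55Z row 7 as the middle cell]: a maximal smooth solution with lifespan T,
Leray–Hopf from a rapidly decaying datum, which deposits no energy atom at T, has ‖u(t) − u(T)‖_{L²}
→ 0 as t ↑ T (NS cannot smear a positive energy quantum over an uncountable 𝓗¹-null dust). [deps:
NoEnergyAtom] [difficulty: open-problem] -/
@[route_item "route-NavierStokesRegularity-RootDecompLitSlice", crux]
def AtomFreeBlowupIsTame : Prop :=
  ∀ (ν T : ℝ), 0 < ν → 0 < T → ∀ (u : ℝ → EuclideanSpace ℝ (Fin 3) → EuclideanSpace ℝ (Fin 3)) (p : ℝ → EuclideanSpace ℝ (Fin 3) → ℝ), Literature.Analysis.FluidPDE.IsMaximalSmoothSolution ν 0 u p T → Literature.Analysis.FluidPDE.IsLerayHopfOn T ν 0 (u 0) u → Literature.Analysis.FluidPDE.HasRapidSpatialDecay (u 0) → (∀ (x₀ : EuclideanSpace ℝ (Fin 3)) (η : NNReal), 0 < η → ∃ r : ℝ, 0 < r ∧ ∀ᶠ t in nhdsWithin T (Set.Iio T), ∫⁻ x in Metric.ball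 x₀ r, ‖u t x‖ₑ ^ 2 < (η : ENNReal)) → Filter.Tendsto (fun t => MeasureTheory.eLpNorm (u t - u T) 2 MeasureTheory.volume) (nhdsWithin T (Set.Iio T)) (nhds 0)

/-- item stmt-NavierStokesRegularity-1217 · crux · rank 8 · open · by planner
why it might fail: a discretely self-similar or non-scale-periodic Type-I singularity from a Schwartz datum; bounded-ancient Liouville open
sources: arXiv:0709.3599, arXiv:1811.00502, Tsai1998
[target] X = NO TYPE-I BLOW-UP FOR CLAY DATA: a classical solution of unforced NS on ℝ³×[0,T) which
is Leray–Hopf from a rapidly decaying datum and blows up at most at the Type-I rate ‖u(t)‖∞ ≤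
C(T−t)^{-1/2} extends smoothly past T. Equals UnthreadedNoBlowup ∧ ThreadedNoBlowup by excluded
middle on 'every point is unthreaded' (proved in the planner's Sketch.lean: target_of_cruxes); it is
the unconditional conclusion of stmt-NavierStokesRegularity-0058 (route TypeILiouville, which
assumes (L)). With NoTypeII (stmt-0056) it gives NoBlowup (stmt-0054). Card:
threading-flux-trace-topology. -/
@[route_item "route-NavierStokesRegularity-RootDecompLitSlice", crux]
def NoTypeIBlowup : Prop :=
  ∀ (ν T : ℝ), 0 < ν → 0 < T → ∀ (u : ℝ → EuclideanSpace ℝ (Fin 3) → EuclideanSpace ℝ (Fin 3)) (p : ℝ → EuclideanSpace ℝ (Fin 3) → ℝ), Literature.Analysis.FluidPDE.IsClassicalNSSolutionOn (Set.Ico 0 T) ν 0 u p → Literature.Analysis.FluidPDE.IsLerayHopfOn T ν 0 (u 0) u → Literature.Analysis.FluidPDE.HasRapidSpatialDecay (u 0) → Literature.Analysis.FluidPDE.IsTypeIBlowup u T → Literature.Analysis.FluidPDE.HasSmoothExtensionPast ν 0 u T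

/-- item stmt-NavierStokesRegularity-29566 · crux · rank 9 · closed · proved by Summit.NavierStokesRegularity.NavierStokesRegularity.Theorems.darkBallSpreads (planner) · by planner
why it might fail: the EFV inequality is printed for scalar equations; the diagonal-system (vorticity) version is folklore only
sources: arXiv:math/0611462, arXiv:0710.2192, CKN1982, EscauriazaSereginSverak2003
[support] ASIDE D₁ — STUB 1 of D's birth skeleton (named `stub_darkBallSpreads`; provable class M/L;
provers on D land it `--supports`): if u(T) = 0 a.e. on some ball then u(T) = 0 a.e. on ℝ³. Plan:
CKN H¹(Sing_T) = 0 ⟹ the regular part of the slice is open, conull, reached from the dark ball along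
a.e. ray; Escauriaza–Fernández–Vessella 2006 Thm 2 (two-sphere one-cylinder / slice doubling,
arXiv:math/0611462 p.4) for the vorticity inequality |∂ₜω − νΔω| ≤ M(|ω|+|∇ω|) in every regular
backward cylinder up to t = T (vector version by summed Carleman = support lemma); curl = div = 0 ⟹
harmonic ⟹ identity theorem -/
@[route_item "route-NavierStokesRegularity-RootDecompLitSlice", crux]
def DarkBallSpreads : Prop :=
  ∀ (ν T : ℝ), 0 < ν → 0 < T → ∀ (u : ℝ → EuclideanSpace ℝ (Fin 3) → EuclideanSpace ℝ (Fin 3)) (p : ℝ → EuclideanSpace ℝ (Fin 3) → ℝ), Literature.Analysis.FluidPDE.IsMaximalSmoothSolution ν 0 u p T → Literature.Analysis.FluidPDE.IsLerayHopfOn T ν 0 (u 0) u → Literature.Analysis.FluidPDE.HasRapidSpatialDecay (u 0) → ∀ (x₀ : EuclideanSpace ℝ (Fin 3)) (ρ : ℝ), 0 < ρ → (∀ᵐ x ∂(MeasureTheory.volume.restrict (Metric.ball x₀ ρ)), u T x = 0) → ∀ᵐ x ∂(MeasureTheory.volume : MeasureTheory.Measure (EuclideanSpace ℝ (Fin 3))),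 u T x = 0

-- `DarkBallSpreads` holds: proved by `Summit.NavierStokesRegularity.NavierStokesRegularity.Theorems.darkBallSpreads` (its module imports this route file, so no `_holds` link can be stated here).

/-- item stmt-NavierStokesRegularity-29567 · crux · rank 9 · closed · proved by Summit.NavierStokesRegularity.NavierStokesRegularity.Theorems.NoGlobalExtinction.noGlobalExtinction_proof (planner) · by planner
why it might fail: only through a gap in identifying the Clay-class blow-up solution with the tree's local Leray class on the slab (pressure normalisation); the analysis is landed
sources: GKP2016, EscauriazaSereginSverak2003, arXiv:1907.00256, LemarieRieusset2016, arXiv:1809.02109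
[support] ASIDE D₂ — STUB 2 of D's birth skeleton (named `stub_noGlobalExtinction`; provable class
M; ENGINE LANDED `IsClassicalNSSolutionOn.curl_eq_zero_of_farField_of_tendsto` and PLUGGED — the
PROVED rung `curl_eq_zero_of_extinct_of_farField`: global darkness + far-field derivative bounds ⟹
curl u ≡ 0 on (T₄,T) × ℝ³): the terminal slice of a first blow-up is not a.e. zero. Remaining inputs
in tree: `leray_solution_farField_bound_slab_holds` (far-field L^∞),
`localLeray_exterior_vorticity_regular_of_bounded_slab_holds` (Serrin exterior derivative bounds),
Kato ⟹ local Leray on the slab, L² harmonic Liouville, extension past T by zero. ALONE it already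
evicts every NSI blow-up IN PRINT (all globally extinct) -/
@[route_item "route-NavierStokesRegularity-RootDecompLitSlice"]
def NoGlobalExtinction : Prop :=
  ∀ (ν T : ℝ), 0 < ν → 0 < T → ∀ (u : ℝ → EuclideanSpace ℝ (Fin 3) → EuclideanSpace ℝ (Fin 3)) (p : ℝ → EuclideanSpace ℝ (Fin 3) → ℝ), Literature.Analysis.FluidPDE.IsMaximalSmoothSolution ν 0 u p T → Literature.Analysis.FluidPDE.IsLerayHopfOn T ν 0 (u 0) u → Literature.Analysis.FluidPDE.HasRapidSpatialDecay (u 0) → ¬ (∀ᵐ x ∂(MeasureTheory.volume : MeasureTheory.Measure (EuclideanSpace ℝ (Fin 3))), u T x = 0)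

-- `NoGlobalExtinction` holds: proved by `Summit.NavierStokesRegularity.NavierStokesRegularity.Theorems.NoGlobalExtinction.noGlobalExtinction_proof` (its module imports this route file, so no `_holds` link can be stated here).

/-- item stmt-NavierStokesRegularity-27390 · support · rank 9 · closed · proved by Summit.NavierStokesRegularity.NavierStokesRegularity.Theorems.generalWindowTradeoff (planner) · by planner
[support] STg «FREE-WINDOW SCAR–MODULUS TRADE-OFF» — THEOREM-GRADE, provable now, M-sized ·
STRENGTHENS the FIRST PROVER TARGET ST ⟨31791⟩ `ScarModulusTradeoff` (KERNEL EDGE ST ⟸ STg at τ =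
r²: `WriterG32.scarModulusTradeoff_of_generalWindow` in the writer g32 evidence file
ScarExponentDial_g32.lean, sha256 a2b70d2daa73, lean rc 0 / 0 sorry / axioms std) · SAME frame as ST
(classical on [0,T), Leray–Hopf on [0,T], rapidly decaying datum), SAME proof and SAME two
registered stubs with the window length τ FREED from r² (Hardy ∫_{B_r}|f|² ≤ 4r²‖∇f‖₂²; energy
identity 2ν∫_{T−τ}^{T}‖∇u‖₂² ≤ ‖u(T−τ)‖₂² − ‖u(T)‖₂² ≤ 2‖u(0)‖₂√H with weak lower semicontinuity at
t = T; average over the window): if ∫|u(t) − u(T)|² ≤ H for all t ∈ [T−τ, T) (0 < r, 0 < τ < T, 0 ≤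
H) then ∫_{B_r(x₀)}|u(T)|² ≤ 2H + (8‖u(0)‖₂/ν)(r²/τ)√H. ROLE (critic decomp-ns-crit-1 g11
CRITIC-LEDGER row 563 CONCUR/RULING on writer g32 NOTE/BLOCKER STATUS L1752; filed as SUPPORT, rank
9): one hand proves STg and closes ST by the corollary (no re-typing of ST); STg is the engine of
the CLOCK→SCAR TRANSFER LAW α(b) = 4b/(b+2) (kernel `WriterG32.clockScarRung_of_generalWindow`, 0 <
b ≤ 2, optimal super-parabolic window τ* ≍ r^{4/(b -/
@[route_item "route-NavierStokesRegularity-RootDecompLitSlice"]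
def GeneralWindowTradeoff : Prop :=
  ∀ (ν T : ℝ), 0 < ν → 0 < T → ∀ (u : ℝ → EuclideanSpace ℝ (Fin 3) → EuclideanSpace ℝ (Fin 3)) (p : ℝ → EuclideanSpace ℝ (Fin 3) → ℝ), Literature.Analysis.FluidPDE.IsClassicalNSSolutionOn (Set.Ico 0 T) ν 0 u p → Literature.Analysis.FluidPDE.IsLerayHopfOn T ν 0 (u 0) u → Literature.Analysis.FluidPDE.HasRapidSpatialDecay (u 0) → ∀ (x₀ : EuclideanSpace ℝ (Fin 3)) (r τ H : ℝ), 0 < r → 0 < τ → τ < T → 0 ≤ H → (∀ t ∈ Set.Ico (T - τ) T, ∫⁻ x, ‖u t x - u T x‖ₑ ^ 2 ≤ ENNReal.ofReal H) → ∫ x in Metric.ball x₀ r, ‖u T x‖ ^ 2 ≤ 2 * H + 8 * Real.sqrt (∫ x, ‖u 0 x‖ ^ 2) / ν * (r ^ 2 / τ) * Real.sqrt H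

-- `GeneralWindowTradeoff` holds: proved by `Summit.NavierStokesRegularity.NavierStokesRegularity.Theorems.generalWindowTradeoff` (its module imports this route file, so no `_holds` link can be stated here).

/-- item stmt-NavierStokesRegularity-27391 · support · rank 9 · closed · proved by Summit.NavierStokesRegularity.NavierStokesRegularity.Theorems.fourFifthsVisibleScar (planner) · by planner
[support] HV♯ «FOUR-FIFTHS VISIBILITY OF CRITICALLY TAME SCARS» — THEOREM-GRADE modulo STg
`GeneralWindowTradeoff` ⟨27390⟩ (KERNEL EDGE HV♯ ⟸ STg:
`WriterG32.fourFifthsVisibleScar_of_generalWindow` = the clock→scar law α(b) = 4b/(b+2) at b = 1/2,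
4·(1/2)/(1/2+2) = 4/5, window τ = r^{8/5}; writer g32 evidence file ScarExponentDial_g32.lean sha256
a2b70d2daa73, lean rc 0 / 0 sorry / axioms std) · the NEW BC5 RUNG of the cell Uᶜ
`CritTameScarIsCritical` ⟨31733⟩, SUPERSEDING HV `HalfVisibleScar` ⟨31792⟩ (HV stays and closes from
HV♯ by the kernel edge `WriterG32.halfVisibleScar_of_fourFifths`, r^{4/5} ≤ √r for r ≤ 1) · STRICTLY
WEAKER than Uᶜ by scaling (scar order 4/5 < 1 = Uᶜ's conclusion; critic decomp-ns-crit-1 g11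
CRITIC-LEDGER row 563 CONCUR/RULING on writer g32 NOTE/BLOCKER STATUS L1752; filed as SUPPORT, rank
9). Statement: HV's hypotheses VERBATIM — classical on [0,T), Leray–Hopf on [0,T], rapidly decaying
datum, critically tame at T (∃ K, T₁ < T with ∫|u(t)−u(T)|² ≤ K√(T−t) for t ∈ (T₁,T)) ⇒ at every x₀:
∃ C, r₁ > 0, ∀ r ∈ (0,r₁), ∫_{B_r(x₀)}|u(T)|² ≤ C·r^{4/5}. CONSEQUENCE for the tenure of Uᶜ (critic
ruling (4)): Uᶜ's filed enemy |u(T,x)| ~ |x−x₀|^{-5/4} (scar order 1/2) is -/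
@[route_item "route-NavierStokesRegularity-RootDecompLitSlice"]
def FourFifthsVisibleScar : Prop :=
  ∀ (ν T : ℝ), 0 < ν → 0 < T → ∀ (u : ℝ → EuclideanSpace ℝ (Fin 3) → EuclideanSpace ℝ (Fin 3)) (p : ℝ → EuclideanSpace ℝ (Fin 3) → ℝ), Literature.Analysis.FluidPDE.IsClassicalNSSolutionOn (Set.Ico 0 T) ν 0 u p → Literature.Analysis.FluidPDE.IsLerayHopfOn T ν 0 (u 0) u → Literature.Analysis.FluidPDE.HasRapidSpatialDecay (u 0) → (∃ K T₁ : ℝ, T₁ < T ∧ ∀ t ∈ Set.Ioo T₁ T, ∫⁻ x, ‖u t x - u T x‖ₑ ^ 2 ≤ ENNReal.ofReal (K * Real.sqrt (T - t))) → ∀ x₀ : EuclideanSpace ℝ (Fin 3), ∃ C r₁ : ℝ, 0 < r₁ ∧ ∀ r ∈ Set.Ioo 0 r₁, ∫ x in Metric.ball x₀ r, ‖u T x‖ ^ 2 ≤ C * r ^ (4 / 5 : ℝ)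

-- `FourFifthsVisibleScar` holds: proved by `Summit.NavierStokesRegularity.NavierStokesRegularity.Theorems.fourFifthsVisibleScar` (its module imports this route file, so no `_holds` link can be stated here).

/-- item stmt-NavierStokesRegularity-27392 · aside · rank 9 · closed · proved by Summit.NavierStokesRegularity.NavierStokesRegularity.Theorems.twoThirdsTameScarIsCritical (planner) · by planner
[aside] (2/3)-CELL «(2/3)-CLOCK-TAME SOLUTIONS HAVE CRITICAL SCARS» — NAMED RUNG, ASIDE ONLY: banked
context, never staffed, never counted as progress (critic decomp-ns-crit-1 g11 CRITIC-LEDGER row 563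
ruling (3) on writer g32 NOTE/BLOCKER STATUS L1752: a re-split of Uᶜ ⟨31733⟩ along the (2/3)-clock
would be decoration-by-theorem, L-CONSERVATION 354 / T5–T2) · THEOREM-GRADE modulo STg
`GeneralWindowTradeoff` ⟨27390⟩ (KERNEL EDGE ⟸ STg:
`WriterG32.twoThirdsTameScarIsCritical_of_generalWindow` = the clock→scar law α(b) = 4b/(b+2) at b =
2/3, 4·(2/3)/(2/3+2) = 1, window τ = r^{3/2}; writer g32 evidence file ScarExponentDial_g32.lean
sha256 a2b70d2daa73, lean rc 0 / 0 sorry / axioms std) · a CLOSED SUB-CELL of Uᶜ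
`CritTameScarIsCritical`: on the classical frame (classical on [0,T), Leray–Hopf on [0,T], rapidly
decaying datum) a (2/3)-clock at T (∃ K, T₁ < T with ∫|u(t)−u(T)|² ≤ K(T−t)^{2/3} for t ∈ (T₁,T))
forces U's conclusion VERBATIM — ∀ x₀ ∃ M, r₁ > 0, ∀ r ∈ (0,r₁), r⁻¹∫_{B_r(x₀)}|u(T)|² ≤ M; the
(2/3)-clock class lies inside Uᶜ's √-clock class near T (`WriterG32.critTame_of_twoThirdsClock`).
RIDER (in this docstring by the critic's ruling, not a separate item): the LITERAL maximal -/
@[route_item "route-NavierStokesRegularity-RootDecompLitSlice"]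
def TwoThirdsTameScarIsCritical : Prop :=
  ∀ (ν T : ℝ), 0 < ν → 0 < T → ∀ (u : ℝ → EuclideanSpace ℝ (Fin 3) → EuclideanSpace ℝ (Fin 3)) (p : ℝ → EuclideanSpace ℝ (Fin 3) → ℝ), Literature.Analysis.FluidPDE.IsClassicalNSSolutionOn (Set.Ico 0 T) ν 0 u p → Literature.Analysis.FluidPDE.IsLerayHopfOn T ν 0 (u 0) u → Literature.Analysis.FluidPDE.HasRapidSpatialDecay (u 0) → (∃ K T₁ : ℝ, T₁ < T ∧ ∀ t ∈ Set.Ioo T₁ T, ∫⁻ x, ‖u t x - u T x‖ₑ ^ 2 ≤ ENNReal.ofReal (K * (T - t) ^ (2 / 3 : ℝ))) → ∀ x₀ : EuclideanSpace ℝ (Fin 3), ∃ M r₁ : ℝ, 0 < r₁ ∧ ∀ r ∈ Set.Ioo 0 r₁, r⁻¹ * ∫ x in Metric.ball x₀ r, ‖u T x‖ ^ 2 ≤ M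

-- `TwoThirdsTameScarIsCritical` holds: proved by `Summit.NavierStokesRegularity.NavierStokesRegularity.Theorems.twoThirdsTameScarIsCritical` (its module imports this route file, so no `_holds` link can be stated here).

/-- item stmt-NavierStokesRegularity-29568 · aside · rank 9 · open · by planner
why it might fail: NS-side it cannot fail unless D fails (D ⟹ T₃ᴰ); its NSI analogue is false (Scheffer/Ożański cascades)
sources: arXiv:1709.00602, arXiv:1809.02109
[aside] T₃ᴰ NO DARK INVISIBLE TRANSIENT — the dark cell of g4's T₃ (T₃ ⟺ T₃ᴸ ∧ T₃ᴰ): MODEL-INHABITED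
by the printed NSI switching cascades (dark ✓ extinct, tame ✓, scar 0 ✓, budget A(r_n) ≍ (6/5)^{2n}
→ ∞ ✓, g3 census); NS-side ⟸ D by vacuity (kernel `darkCells_of_noDarkBall`); recorded for the
exactness E₂ ⟺ U ∧ T₃ᴸ ∧ T₃ᴰ ∧ G₂ᴸ ∧ G₂ᴰ; never staffed -/
@[route_item "route-NavierStokesRegularity-RootDecompLitSlice"]
def NoDarkInvisibleTransient : Prop :=
  ∀ (ν T : ℝ), 0 < ν → 0 < T → ∀ (u : ℝ → EuclideanSpace ℝ (Fin 3) → EuclideanSpace ℝ (Fin 3)) (p : ℝ → EuclideanSpace ℝ (Fin 3) → ℝ), Literature.Analysis.FluidPDE.IsMaximalSmoothSolution ν 0 u p T → Literature.Analysis.FluidPDE.IsLerayHopfOn T ν 0 (u 0) u → Literature.Analysis.FluidPDE.HasRapidSpatialDecay (u 0) → Filter.Tendsto (fun t => MeasureTheory.eLpNorm (u t - u T) 2 MeasureTheory.volume) (nhdsWithin T (Set.Iio T)) (nhds 0) → ∀ x₀ : EuclideanSpace ℝ (Fin 3), (∃ ρ : ℝ, 0 < ρ ∧ ∀ᵐ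 x ∂(MeasureTheory.volume.restrict (Metric.ball x₀ ρ)), u T x = 0) → (∃ M r₁ : ℝ, 0 < r₁ ∧ ∀ r ∈ Set.Ioo 0 r₁, r⁻¹ * ∫ x in Metric.ball x₀ r, ‖u T x‖ ^ 2 ≤ M) → ∃ M r₀ : ℝ, 0 < r₀ ∧ ∀ r ∈ Set.Ioo 0 r₀, ∀ t ∈ Set.Ioo (T - r ^ 2) T, r⁻¹ * ∫ x in Metric.ball x₀ r, ‖u t x‖ ^ 2 ≤ M

/-- item stmt-NavierStokesRegularity-29569 · aside · rank 9 · open · by planner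
why it might fail: NS-side it cannot fail unless D fails (D ⟹ G₂ᴰ); its NSI analogue is false (Scheffer's Type-I-rate cascade)
sources: arXiv:1709.00602, Seregin2014
[aside] G₂ᴰ A TAME BLOW-UP WITH A DARK CRITICAL SINGULAR VERTEX IS TYPE I — the dark cell of g4's G₂
(G₂ ⟺ G₂ᴸ ∧ G₂ᴰ): MODEL-INHABITED by Scheffer's Type-I-rate cascade; NS-side ⟸ D by vacuity (kernel
`darkCells_of_noDarkBall`); recorded for the exactness at the residual; never staffed -/
@[route_item "route-NavierStokesRegularity-RootDecompLitSlice"]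
def DarkCriticalSingularityIsTypeI : Prop :=
  ∀ (ν T : ℝ), 0 < ν → 0 < T → ∀ (u : ℝ → EuclideanSpace ℝ (Fin 3) → EuclideanSpace ℝ (Fin 3)) (p : ℝ → EuclideanSpace ℝ (Fin 3) → ℝ), Literature.Analysis.FluidPDE.IsMaximalSmoothSolution ν 0 u p T → Literature.Analysis.FluidPDE.IsLerayHopfOn T ν 0 (u 0) u → Literature.Analysis.FluidPDE.HasRapidSpatialDecay (u 0) → Filter.Tendsto (fun t => MeasureTheory.eLpNorm (u t - u T) 2 MeasureTheory.volume) (nhdsWithin T (Set.Iio T)) (nhds 0) → (∃ x₀ : EuclideanSpace ℝ (Fin 3), (∃ ρ : ℝ, 0 < ρ ∧ ∀ᵐ x ∂(MeasureTheory.volume.restrict (Metric.ball x₀ ρ)), u T x = 0) ∧ (∃ M r₀ : ℝ, 0 < r₀ ∧ ∀ r ∈ Set.Ioo 0 r₀, ∀ t ∈ Set.Ioo (T - r ^ 2) T, r⁻¹ * ∫ x in Metric.ball x₀ r, ‖u t x‖ ^ 2 ≤ M) ∧ ¬ (∃ r > 0, ∃ C : ℝ, ∀ t ∈ Set.Ioo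 (T - r ^ 2) T, ∀ x ∈ Metric.ball x₀ r, ‖u t x‖ ≤ C)) → Literature.Analysis.FluidPDE.IsTypeIBlowup u T

/-- item stmt-NavierStokesRegularity-31791 · support · rank 9 · closed · proved by Summit.NavierStokesRegularity.NavierStokesRegularity.Theorems.scarModulusTradeoff (planner) · by planner
[support] ST «THE SCAR–MODULUS TRADE-OFF» — STRENGTHENED (route rev 4–6, writer g32 / critic
decomp-ns-crit-1 g11 CRITIC-LEDGER row 563) by STg `GeneralWindowTradeoff` ⟨27390⟩ = the same
trade-off with the window length τ freed from r²; KERNEL EDGE ST ⟸ STg at τ = r²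
(`WriterG32.scarModulusTradeoff_of_generalWindow`, evidence ScarExponentDial_g32.lean a2b70d2daa73):
PROVE STg, close ST by the corollary · THEOREM-GRADE, provable now, M-sized · FIRST PROVER TARGET of
the lens-6 g8 PARABOLIC CLOCK split of U 29565 on N16 (Uᶜ 31733 / Uᵃ 31734, glue 31735;
HOME/decomp-ns-lens-6/ParabolicClock.lean `ScarModulusTradeoff` verbatim) · stated on the CLASSICAL
frame (classical on [0,T), Leray–Hopf on [0,T], decaying datum) — NOT vacuous under S;
averaging-insensitive (energy identity + Hardy + L²-geometry), valid for EVERY frame solution: the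
energy parked in B_r(x₀) at the terminal time is paid for by the L²-modulus over the last window of
length r²: if ∫|u(t) − u(T)|² ≤ H for all t ∈ [T − r², T) (0 < r, r² < T, 0 ≤ H) then
∫_{B_r(x₀)}|u(T)|² ≤ 2H + (8‖u(0)‖₂/ν)√H. Proof plan (BC3, two stubs): (S1)
stub_windowLocalEnergy_le — Hardy on ℝ³ (∫_{B_r(x₀)}|f|² ≤ 4r²‖∇f‖₂²; anchors Literature/Analy -/
@[route_item "route-NavierStokesRegularity-RootDecompLitSlice"]
def ScarModulusTradeoff : Prop :=
  ∀ (ν T : ℝ), 0 < ν → 0 < T → ∀ (u : ℝ → EuclideanSpace ℝ (Fin 3) → EuclideanSpace ℝ (Fin 3)) (p : ℝ → EuclideanSpace ℝ (Fin 3) → ℝ), Literature.Analysis.FluidPDE.IsClassicalNSSolutionOn (Set.Ico 0 T) ν 0 u p → Literature.Analysis.FluidPDE.IsLerayHopfOn T ν 0 (u 0) u → Literature.Analysis.FluidPDE.HasRapidSpatialDecay (u 0) → ∀ (x₀ : EuclideanSpace ℝ (Fin 3)) (r H : ℝ), 0 < r → r ^ 2 < T → 0 ≤ H → (∀ t ∈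 Set.Ico (T - r ^ 2) T, ∫⁻ x, ‖u t x - u T x‖ₑ ^ 2 ≤ ENNReal.ofReal H) → ∫ x in Metric.ball x₀ r, ‖u T x‖ ^ 2 ≤ 2 * H + 8 * Real.sqrt (∫ x, ‖u 0 x‖ ^ 2) / ν * Real.sqrt H

-- `ScarModulusTradeoff` holds: proved by `Summit.NavierStokesRegularity.NavierStokesRegularity.Theorems.scarModulusTradeoff` (its module imports this route file, so no `_holds` link can be stated here).

/-- item stmt-NavierStokesRegularity-31792 · support · rank 9 · closed · proved by Summit.NavierStokesRegularity.NavierStokesRegularity.Theorems.halfVisibleScar (planner) · by planner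
[support] HV «HALF-VISIBILITY OF CRITICALLY TAME SCARS» — THEOREM-GRADE (HV ⟸ ST is KERNEL: lens
`halfVisibleScar_of_tradeoff`, re-proved on the tree decls in the writer's GlueProofN16U.lean),
lands with ST · the BC5 RUNG of the cell Uᶜ 31733 (Uᶜ says scar order N = 1; HV proves N ≥ 1/2 on
the same critically-tame class; classical frame, not vacuous under S): classical on [0,T),
Leray–Hopf on [0,T], decaying datum, critically tame at T (∫|u(t)−u(T)|² ≤ K√(T−t) near T) ⇒ at
every x₀: ∃ C r₁>0, ∀ r<r₁, ∫_{B_r(x₀)}|u(T)|² ≤ C√r. why it might fail: it cannot given ST (kernel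
edge). sources: CKN1982, Leray1934, LeslieShvydkoy2017. [difficulty: S given ST] -/
@[route_item "route-NavierStokesRegularity-RootDecompLitSlice"]
def HalfVisibleScar : Prop :=
  ∀ (ν T : ℝ), 0 < ν → 0 < T → ∀ (u : ℝ → EuclideanSpace ℝ (Fin 3) → EuclideanSpace ℝ (Fin 3)) (p : ℝ → EuclideanSpace ℝ (Fin 3) → ℝ), Literature.Analysis.FluidPDE.IsClassicalNSSolutionOn (Set.Ico 0 T) ν 0 u p → Literature.Analysis.FluidPDE.IsLerayHopfOn T ν 0 (u 0) u → Literature.Analysis.FluidPDE.HasRapidSpatialDecay (u 0) → (∃ K T₁ : ℝ, T₁ < T ∧ ∀ t ∈ Set.Ioo T₁ T, ∫⁻ x, ‖u t x - u T x‖ₑ ^ 2 ≤ ENNReal.ofReal (K * Real.sqrt (T - t))) → ∀ x₀ : EuclideanSpace ℝ (Fin 3), ∃ C r₁ : ℝ, 0 < r₁ ∧ ∀ r ∈ Set.Ioo 0 r₁, ∫ x in Metric.ball x₀ r, ‖u T x‖ ^ 2 ≤ C * Real.sqrt r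

-- `HalfVisibleScar` holds: proved by `Summit.NavierStokesRegularity.NavierStokesRegularity.Theorems.halfVisibleScar` (its module imports this route file, so no `_holds` link can be stated here).

/-- item stmt-NavierStokesRegularity-32341 · support · rank 9 · open · by planner
[support] JV · A QUIET BUDGETED VERTEX IS REGULAR — blow-up staticity (lens-6 g12 «THE QUIET
LANDING», CRITIC-LEDGER row 114 CLEARED (modest): «B1 exact/sound, B2 minimal; mild preference B2
now, B1 later» — this is B2: JV filed as support of N16 wanted by Uᶜ CritTameScarIsCritical 31733,
the g8 split kept; B1 = `--resplit NoSupercriticalTameScar --into QuietTameScarIsCritical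
ClockedTameScarIsCritical AbruptTameScarIsCritical` deferred). NEW; THEOREM-GRADE (expected),
ATTACKABLE NOW; not vacuous under S (`QuietLanding.quietBudgetedVertexRegular_of_root` via
`FastClassSqueeze.bounded_of_hasSmoothExtensionPast`); averaging-SENSITIVE (LEI / ε-regularity:
outside Tao's class by construction of the proof). Statement: classical on [0,T), Leray–Hopf on
[0,T] from a rapidly decaying datum; at a vertex x₀ with bounded centred budget (∃ M r₀>0, ∀ r<r₀, ∀
t∈(T−r²,T), r⁻¹∫_{B_r(x₀)}|u(t)|² ≤ M) which is locally quiet (∀ ε>0 ∃ r₀>0 ∀ r<r₀ ∀ t∈(T−r²,T),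
r⁻¹∫_{B_r(x₀)}|u(t)−u(T)|² ≤ ε), u is backward bounded: ∃ r>0, C, ∀ t∈(T−r²,T), ∀ x∈B_r(x₀),
|u(t,x)| ≤ C. ROLE (kernel, lens file QuietLanding.lean sha256 e86cffb7…, 0 sorry): the g8 child Uᶜ
31733 splits EXACTLY as Uᶜ ⟺ U° `QuietTameScarIsCrit -/
@[route_item "route-NavierStokesRegularity-RootDecompLitSlice"]
def QuietBudgetedVertexRegular : Prop :=
  ∀ (ν T : ℝ), 0 < ν → 0 < T → ∀ (u : ℝ → EuclideanSpace ℝ (Fin 3) → EuclideanSpace ℝ (Fin 3)) (p : ℝ → EuclideanSpace ℝ (Fin 3) → ℝ), Literature.Analysis.FluidPDE.IsClassicalNSSolutionOn (Set.Ico 0 T) ν 0 u p → Literature.Analysis.FluidPDE.IsLerayHopfOn T ν 0 (u 0) u → Literature.Analysis.FluidPDE.HasRapidSpatialDecay (u 0) → ∀ x₀ : EuclideanSpace ℝ (Fin 3), (∃ M r₀ : ℝ, 0 < r₀ ∧ ∀ r ∈ Set.Ioo 0 r₀, ∀ t ∈ Set.Ioo (T - r ^ 2) T, r⁻¹ * ∫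 x in Metric.ball x₀ r, ‖u t x‖ ^ 2 ≤ M) → (∀ ε : ℝ, 0 < ε → ∃ r₀ : ℝ, 0 < r₀ ∧ ∀ r ∈ Set.Ioo 0 r₀, ∀ t ∈ Set.Ioo (T - r ^ 2) T, r⁻¹ * ∫ x in Metric.ball x₀ r, ‖u t x - u T x‖ ^ 2 ≤ ε) → ∃ r > 0, ∃ C : ℝ, ∀ t ∈ Set.Ioo (T - r ^ 2) T, ∀ x ∈ Metric.ball x₀ r, ‖u t x‖ ≤ C

/-- item stmt-NavierStokesRegularity-29570 · assembly · rank 1 · closed · proved by Summit.NavierStokesRegularity.NavierStokesRegularity.Theorems.RootDecompLitSliceAssembly.assembly_holds (prover) · by planner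
sources: Fefferman2000, CKN1982
[assembly] the implication the glue proves: P1 → P2 → J1 → U → T₃ᴸ → G₂ᴸ → D → Clay (A) (all seven
consumed; = lens `closes_N1` through N1's `RootDecompTerminalEnergy.closes`). -/
@[route_item "route-NavierStokesRegularity-RootDecompLitSlice"]
def Assembly : Prop :=
  NoTypeIBlowup → NoEnergyAtom → AtomFreeBlowupIsTame → NoSupercriticalTameScar → NoLitInvisibleTransient → LitCriticalSingularityIsTypeI → NoDarkBall → NavierStokesRegularity

-- `Assembly` holds: proved by `Summit.NavierStokesRegularity.NavierStokesRegularity.Theorems.RootDecompLitSliceAssembly.assembly_holds` (its module imports this route file, so no `_holds` link can be stated here).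

/-! D-0027 §2.1 — DECIDING THEOREM (planner-authored via `route open/edit --closes-file`; by planner-decomp-ns-writer-1-g3-0 2026-08-30T06:41:59Z):
its hypotheses are this route's items and its conclusion the sub-problem Statement (glue_lint), and it elaborates with this file. -/

@[closes "route-NavierStokesRegularity-RootDecompLitSlice"] theorem closes (hI : NoTypeIBlowup) (hA : NoEnergyAtom) (hJ1 : AtomFreeBlowupIsTame) (hU : NoSupercriticalTameScar)
    (hT : NoLitInvisibleTransient) (hG : LitCriticalSingularityIsTypeI) (hD : NoDarkBall) : NavierStokesRegularity := by
  refine Summit.NavierStokesRegularity.NavierStokesRegularity.Theses.RootDecompTerminalEnergy.closes hI hA hJ1 ?_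
  intro ν T hν hT' u p hmax hLH hdec htame
  obtain ⟨xs, hxs⟩ :=
    Summit.NavierStokesRegularity.NavierStokesRegularity.Theorems.terminalTrace_blowupHasSingularPoint_proof
      ν T hν hT' u p hmax.1 hLH hdec hmax.2
  have hlit : ¬ (∃ ρ : ℝ, 0 < ρ ∧ ∀ᵐ x ∂(MeasureTheory.volume.restrict (Metric.ball xs ρ)), u T x = 0) :=
    fun ⟨ρ, hρ, hae⟩ => hD ν T hν hT' u p hmax hLH hdec xs ρ hρ hae
  have hbud := hT ν T hν hT' u p hmax hLH hdec htame xs hlit (hU ν T hν hT' u p hmax hLH hdec htame xs)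
  refine hG ν T hν hT' u p hmax hLH hdec htame ⟨xs, hlit, hbud, ?_⟩
  rintro ⟨r, hr, C, hC⟩
  have hbound : ∀ᵐ z ∂(MeasureTheory.volume.restrict (Literature.Analysis.FluidPDE.parabolicCylinder r (T, xs))),
      ‖Function.uncurry u z‖ ≤ C := by
    filter_upwards [MeasureTheory.ae_restrict_mem
      (Literature.Analysis.FluidPDE.isOpen_parabolicCylinder r (T, xs)).measurableSet] with z hz
    rw [Literature.Analysis.FluidPDE.mem_parabolicCylinder] at hz
    exact hC z.1 ⟨hz.1.1, hz.1.2⟩ z.2 (Metric.mem_ball.2 hz.2)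
  have hlt : MeasureTheory.eLpNorm (Function.uncurry u) ⊤
      (MeasureTheory.volume.restrict (Literature.Analysis.FluidPDE.parabolicCylinder r (T, xs))) < ⊤ := by
    rw [MeasureTheory.eLpNorm_exponent_top]
    exact MeasureTheory.eLpNormEssSup_lt_top_of_ae_bound hbound
  exact hlt.ne (hxs r hr)

end Summit.NavierStokesRegularity.NavierStokesRegularity.Theses.RootDecompLitSlice
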